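import Summits.ValiantsHypothesis.ValiantsHypothesis.Theorems.GrenetZeonDualUnipotentThreeHalvesLongMassRankOneAcyclicDomain
import Summits.ValiantsHypothesis.ValiantsHypothesis.Theorems.GrenetZeonDualUnipotentThreeHalvesLongMassRankOneAffine

/-!
# `GrenetZeon.DualUnipotentThreeHalves` (stmt-ValiantsHypothesis-24318), line `slow_core`, stub `stub_longMassSlowLawInv` ((c)):
# THE RESOLVENT GRAM MATRIX of a rank-one family with an ARBITRARY nilpotent constant part carries levels

Setting: `A₀ : M_m(ℂ)` with `A₀^m = 0` and a rank-one family `V_e = u_e w_eᵀ` (`e : κ`) such that EVERY member of the homogenised span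
`c·A₀ + Σ_e x_e V_e` is nilpotent (`(·)^{h+1} = 0`).  RESOLVENT `R_s := Σ_{a<m} (s•A₀)^a = (1 − sA₀)⁻¹` and resolvent GRAM MATRIX
`𝒢(s) e e' := Σ_{a<m} (w_e · A₀^a u_{e'}) s^a = (Wᵀ R_s U) e e' ∈ ℂ[s]`.

* §1 `resolvent_mul`, `mul_resolvent` — `R_s (1 − s•A₀) = (1 − s•A₀) R_s = 1` (geometric sum).
* §2 ★ `pow_resolvent_mul_eq_zero` — `(R_s · Y)^m = 0` for every member `Y`: `charpoly(R_s Y)(λ) = det R_s · det(λ − (λs·A₀ + Y)) = det R_s · λ^m`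
  for EVERY `λ` (the bracket is a member, nilpotent), so `charpoly(R_s Y) = C(det R_s)·X^m`; monic ⇒ `= X^m`; Cayley–Hamilton.
* §3 `gramPoly_pow_eq_zero` — hence (✓ `hereditarilyNilpotent_gram` with `U ↦ R_s U` at every `s`, uniform exponent by ✓
  `SlowCore.pow_card_eq_zero_of_pow_eq_zero`, then ✓ `Polynomial.funext`) every principal submatrix of the POLYNOMIAL matrix `𝒢 ∈ M_κ(ℂ[s])` is
  nilpotent, and ✓ `exists_levels_vanishing_of_hereditarilyNilpotent` (domain `ℂ[s]`, ✓ `…LongMassRankOneAcyclicDomain`) gives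
  ★★ `exists_levels_resolvent`: levels `ℓ : κ → ℕ` with `ℓ e' ≤ ℓ e → w_e · A₀^a u_{e'} = 0` for ALL `a`.

USE (sequel `…LongMassRankOneGeneral`): the flag `span{A₀^a u_e : ℓ e < t}` is `A₀`-stable and lowered by every `V_e`, so McCoy triangularises
`{A₀} ∪ {V_e}` and (c) holds with `c = 3` for EVERY affine nilpotent pencil whose LINEAR coefficient matrices all have rank `≤ 1` (constant part
arbitrary).  Honest framing: support lemma (`--supports stmt-ValiantsHypothesis-24318`); (c), S3, 24318, 8062, VP ≠ VNP OPEN / NOT proved.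
No sorry, no definitions, no named facts. [folklore]
-/

-- single-conjunct layout: Sub = Summit, duplicated namespace component intended (the name is mandated)
set_option linter.dupNamespace false
set_option autoImplicit false

noncomputable section

namespace Summit.ValiantsHypothesis.ValiantsHypothesis.Theorems.GrenetZeon.LongMassRankOne

open Matrix Polynomial
open scoped BigOperators

variable {m : ℕ}

/-! ## §1 The resolvent of a nilpotent matrix -/

/-- `R_s (1 − s•A₀) = 1` for `A₀^m = 0`. -/
theorem resolvent_mul (A₀ : Matrix (Fin m) (Fin m) ℂ) (hA : A₀ ^ m = 0) (s : ℂ) :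
    (∑ a ∈ Finset.range m, (s • A₀) ^ a) * (1 - s • A₀) = 1 := by
  rw [geom_sum_mul_neg, _root_.smul_pow, hA, smul_zero, sub_zero]

/-- `(1 − s•A₀) R_s = 1` for `A₀^m = 0`. -/
theorem mul_resolvent (A₀ : Matrix (Fin m) (Fin m) ℂ) (hA : A₀ ^ m = 0) (s : ℂ) :
    (1 - s • A₀) * (∑ a ∈ Finset.range m, (s • A₀) ^ a) = 1 := by
  rw [mul_neg_geom_sum, _root_.smul_pow, hA, smul_zero, sub_zero]

/-! ## §2 `R_s · Y` is nilpotent for every member `Y` of the span -/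

/-- The characteristic polynomial of a nilpotent complex matrix is `X^m`. [folklore] -/
theorem charpoly_eq_X_pow_of_pow_eq_zero (N : Matrix (Fin m) (Fin m) ℂ) {k : ℕ} (hN : N ^ k = 0) : N.charpoly = X ^ m := by
  have hnil : IsNilpotent (N.charpoly - X ^ m) := by
    simpa [Fintype.card_fin] using Matrix.isNilpotent_charpoly_sub_pow_of_isNilpotent ⟨k, hN⟩
  exact sub_eq_zero.1 hnil.eq_zero

/-- `scalar t = t • 1`. -/
theorem scalar_eq_smul_one (t : ℂ) : Matrix.scalar (Fin m) t = t • (1 : Matrix (Fin m) (Fin m) ℂ) := by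
  ext i j
  rw [Matrix.scalar_apply, Matrix.diagonal_apply, Matrix.smul_apply, Matrix.one_apply, smul_eq_mul, mul_ite, mul_one, mul_zero]

/-- ★ **`(R_s Y)^m = 0`.**  If `A₀^m = 0` and every `c•A₀ + Y` (`c : ℂ`) satisfies `(·)^{h+1} = 0`, the resolvent-twisted member `R_s · Y` is
nilpotent: `charpoly(R_s Y)(λ) = det R_s · det(λ − (λs•A₀ + Y)) = det R_s · λ^m` for every `λ`; the characteristic polynomial is monic. [folklore] -/
theorem pow_resolvent_mul_eq_zero (A₀ Y : Matrix (Fin m) (Fin m) ℂ) (hA : A₀ ^ m = 0) {h : ℕ}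
    (hnil : ∀ c : ℂ, (c • A₀ + Y) ^ (h + 1) = 0) (s : ℂ) :
    ((∑ a ∈ Finset.range m, (s • A₀) ^ a) * Y) ^ m = 0 := by
  set R := ∑ a ∈ Finset.range m, (s • A₀) ^ a with hR
  have hRT : R * (1 - s • A₀) = 1 := resolvent_mul A₀ hA s
  -- the characteristic polynomial evaluated anywhere
  have heval : ∀ t : ℂ, (R * Y).charpoly.eval t = R.det * t ^ m := by
    intro t
    have hfac : Matrix.scalar (Fin m) t - R * Y = R * (Matrix.scalar (Fin m) t - ((t * s) • A₀ + Y)) := by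
      have h1 : R * (Matrix.scalar (Fin m) t - ((t * s) • A₀ + Y)) = t • (R * (1 - s • A₀)) - R * Y := by
        simp only [scalar_eq_smul_one, Matrix.mul_sub, Matrix.mul_add, Matrix.mul_smul, Matrix.mul_one, smul_sub, smul_smul]
        abel
      rw [h1, hRT, scalar_eq_smul_one]
    rw [Matrix.eval_charpoly, hfac, Matrix.det_mul, ← Matrix.eval_charpoly,
      charpoly_eq_X_pow_of_pow_eq_zero _ (hnil (t * s)), eval_pow, eval_X]
  have hchar : (R * Y).charpoly = C R.det * X ^ m := by
    apply Polynomial.funext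
    intro t
    rw [heval t, eval_mul, eval_C, eval_pow, eval_X]
  have hdet : R.det = 1 := by
    have hmonic := Matrix.charpoly_monic (R * Y)
    rwa [hchar, Polynomial.Monic, leadingCoeff_C_mul_X_pow] at hmonic
  have hCH := Matrix.aeval_self_charpoly (R * Y)
  rw [hchar, hdet, map_one, one_mul, map_pow, aeval_X] at hCH
  rw [hR] at hCH ⊢
  exact hCH

/-! ## §3 The polynomial resolvent Gram matrix is hereditarily nilpotent -/

section Gram

variable {κ : Type*} [Fintype κ] [DecidableEq κ]

omit [Fintype κ] [DecidableEq κ] in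
/-- Evaluating the resolvent Gram polynomial matrix at `s` gives `Wᵀ R_s U`. -/
theorem gramPoly_map_eval (A₀ : Matrix (Fin m) (Fin m) ℂ) (u w : κ → Fin m → ℂ) (s : ℂ) :
    (Matrix.of fun e e' : κ => ∑ a ∈ Finset.range m, C (w e ⬝ᵥ (A₀ ^ a *ᵥ u e')) * X ^ a).map (Polynomial.eval s) =
      (Matrix.of fun e j => w e j) * ((∑ a ∈ Finset.range m, (s • A₀) ^ a) * (Matrix.of fun i e => u e i)) := by
  ext e e'
  rw [Matrix.map_apply, Matrix.of_apply, eval_finsetSum, Matrix.mul_apply]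
  have hrhs : ∑ j, (Matrix.of fun e j => w e j) e j * ((∑ a ∈ Finset.range m, (s • A₀) ^ a) * Matrix.of fun i e => u e i) j e' =
      w e ⬝ᵥ ((∑ a ∈ Finset.range m, (s • A₀) ^ a) *ᵥ u e') := by
    simp only [Matrix.of_apply, dotProduct, Matrix.mulVec, Matrix.mul_apply]
  rw [hrhs, Matrix.sum_mulVec, dotProduct_sum]
  refine Finset.sum_congr rfl fun a _ => ?_
  rw [eval_mul, eval_C, eval_pow, eval_X, _root_.smul_pow, Matrix.smul_mulVec, dotProduct_smul, smul_eq_mul, mul_comm]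

/-- Every principal submatrix of the resolvent Gram polynomial matrix is nilpotent (as a matrix over `ℂ[s]`), with the uniform exponent `k`. -/
theorem gramPoly_submatrix_pow_eq_zero (A₀ : Matrix (Fin m) (Fin m) ℂ) (hA : A₀ ^ m = 0) (u w : κ → Fin m → ℂ) {h : ℕ}
    (hnil : ∀ (c : ℂ) (x : κ → ℂ), (c • A₀ + ∑ e, x e • vecMulVec (u e) (w e)) ^ (h + 1) = 0)
    {k : ℕ} (c : Fin k → κ) (hc : Function.Injective c) :
    ((Matrix.of fun e e' : κ => ∑ a ∈ Finset.range m, C (w e ⬝ᵥ (A₀ ^ a *ᵥ u e')) * X ^ a).submatrix c c) ^ k = 0 := by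
  set 𝒢 : Matrix κ κ ℂ[X] := Matrix.of fun e e' : κ => ∑ a ∈ Finset.range m, C (w e ⬝ᵥ (A₀ ^ a *ᵥ u e')) * X ^ a with h𝒢
  -- pointwise in `s`
  have hpt : ∀ s : ℂ, ((𝒢.map (Polynomial.eval s)).submatrix c c) ^ k = 0 := by
    intro s
    have hval : ∀ x : κ → ℂ, (((∑ a ∈ Finset.range m, (s • A₀) ^ a) * Matrix.of fun i e => u e i) * Matrix.diagonal x *
        (Matrix.of fun e j => w e j)) ^ (m + 1) = 0 := by
      intro x
      rw [Matrix.mul_assoc (∑ a ∈ Finset.range m, (s • A₀) ^ a), Matrix.mul_assoc (∑ a ∈ Finset.range m, (s • A₀) ^ a),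
        ← sum_smul_vecMulVec_eq_mulK, pow_succ, pow_resolvent_mul_eq_zero A₀ _ hA (fun c' => hnil c' x) s, Matrix.zero_mul]
    have hnilsub := hereditarilyNilpotent_gram ((∑ a ∈ Finset.range m, (s • A₀) ^ a) * Matrix.of fun i e => u e i)
      (Matrix.of fun e j => w e j) hval k c hc
    obtain ⟨N, hN⟩ := hnilsub
    have hk := Summit.ValiantsHypothesis.ValiantsHypothesis.Theorems.GrenetZeon.SlowCore.pow_card_eq_zero_of_pow_eq_zero _ hN
    rw [h𝒢, gramPoly_map_eval]
    exact hk
  -- polynomial identity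
  refine Matrix.ext fun a b => ?_
  apply Polynomial.funext
  intro s
  have h1 := congrFun (congrFun (hpt s) a) b
  rw [Matrix.submatrix_map, ← Polynomial.coe_evalRingHom, ← Matrix.map_pow, Matrix.map_apply, Matrix.zero_apply] at h1
  rw [Matrix.zero_apply, eval_zero, ← Polynomial.coe_evalRingHom]
  exact h1

/-- ★★ **LEVELS FROM THE RESOLVENT GRAM MATRIX.**  If `A₀^m = 0` and every member `c•A₀ + Σ x_e u_e w_eᵀ` of the homogenised span is nilpotent
of index `≤ h+1`, the index set carries levels `ℓ` with `w_e · A₀^a u_{e'} = 0` for ALL `a` whenever `ℓ e' ≤ ℓ e`. [this file] -/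
theorem exists_levels_resolvent (A₀ : Matrix (Fin m) (Fin m) ℂ) (hA : A₀ ^ m = 0) (u w : κ → Fin m → ℂ) {h : ℕ}
    (hnil : ∀ (c : ℂ) (x : κ → ℂ), (c • A₀ + ∑ e, x e • vecMulVec (u e) (w e)) ^ (h + 1) = 0) :
    ∃ ℓ : κ → ℕ, ∀ e e' (a : ℕ), ℓ e' ≤ ℓ e → w e ⬝ᵥ (A₀ ^ a *ᵥ u e') = 0 := by
  classical
  obtain ⟨ℓ, hℓ⟩ := exists_levels_vanishing_of_hereditarilyNilpotent
    (Matrix.of fun e e' : κ => ∑ a ∈ Finset.range m, C (w e ⬝ᵥ (A₀ ^ a *ᵥ u e')) * X ^ a)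
    (fun k c hc => ⟨k, gramPoly_submatrix_pow_eq_zero A₀ hA u w hnil c hc⟩)
  refine ⟨ℓ, fun e e' a hle => ?_⟩
  by_cases ha : a < m
  · have h0 := hℓ e e' hle
    rw [Matrix.of_apply] at h0
    have hcoef := congrArg (Polynomial.coeff · a) h0
    simp only [finsetSum_coeff, coeff_C_mul_X_pow, coeff_zero] at hcoef
    rw [Finset.sum_ite_eq (Finset.range m) a, if_pos (Finset.mem_range.mpr ha)] at hcoef
    exact hcoef
  · rw [show a = m + (a - m) by omega, pow_add, hA, Matrix.zero_mul, Matrix.zero_mulVec, dotProduct_zero]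

end Gram

end Summit.ValiantsHypothesis.ValiantsHypothesis.Theorems.GrenetZeon.LongMassRankOne

end
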